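import Literature.Topology.FourManifolds.MorseRearrangementHolds
import Literature.Topology.FourManifolds.MorseRearrangementProofs
import Literature.Topology.FourManifolds.ClosedAsCobordism
import HarnessLib

/-!
# Ordering the critical values of a Morse function above a frozen sublevel set

Topic `Literature/Topology/FourManifolds`; infrastructure for the fact seat
`provefact-Literature.Topology.FourManifolds.exists_isBalancedGKTrisection` (Gay–Kirby 2016,
Thm. 4 via §4, Lemma 14).  Everything in this file is **proved**; no definitions, no named
facts.

The Heegaard function `φ` of a Morse-theoretic construction of Gay–Kirby's trisection is
obtained from an explicit function near the attaching link (critical points of index `0` and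
`1` only, all below a level `t`) by a relative Morse approximation
(`MorseRelativeExistence.lean`), which leaves arbitrary critical points above `t`.  What
Lemma 14 needs is an **ordered** function: a level `b` with all critical points of index `≤ 1`
below and all of index `≥ 2` above, *the function being untouched below `t`*.  This file
provides that rearrangement, assembled from the tree's slab forms of Milnor's theorems
(*Lectures on the h-cobordism theorem* (1965)):

* `IsMorse.exists_add_bump_apply_notMem` — **Lemma 2.8, one local step**: the value of a Morse
  function at an interior critical point `p` can be moved up by less than `η`, off any given
  finite set of reals, by a bump supported in a prescribed open set around `p`, keeping the
  function elsewhere, its critical points and indices (the tree's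
  `Cobordism.exists_isMorseFunction_apply_notMem` without the support control);
* `IsMorse.exists_injOn_above` — iterating it: the critical values above `t` become pairwise
  distinct, the function being unchanged on `{f ≤ t}` and increased by less than `η`;
* `IsMorse.exists_sorted_above` — **Thm. 4.8 above a level**: on a closed manifold, a Morse
  function with values in `(0, 1)` and no critical value equal to `t` can be replaced by one
  with the same critical points and indices, *equal to it on `{f ≤ t}`*, whose critical points
  above `t` have pairwise distinct values increasing with the index (bubble sort by the slab
  form of Thms. 4.1/4.2/4.4, `Cobordism.Milnor1965_rearrange_consecutive_levels_holds`, each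
  swap supported in a slab above `t`; the closed manifold is the cobordism `(Y; ∅, ∅)`,
  `Cobordism.ofClosed`);
* `IsMorse.exists_ordered_above` — the consequence used by Lemma 14: if all critical points in
  `{f ≤ t}` have index `≤ 1`, there are such a `g` and a regular level `b > t` of `g` below
  which all critical points of `g` have index `≤ 1` and above which all have index `≥ 2`.

## References

* J. Milnor, *Lectures on the h-cobordism theorem* (1965), Lemma 2.8 (PDF p. 11), Thms. 4.1,
  4.2, 4.4, 4.8 (PDF pp. 22–25). [MilnorHCobordism1965]
* D. Gay, R. Kirby, *Trisecting 4-manifolds*, Geom. Topol. 20 (2016), §4, Lemma 14.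
  [GayKirby2016]
-/

open scoped Manifold ContDiff Topology
open Set Function Filter Metric

noncomputable section

universe u

namespace Literature.Topology.FourManifolds

/-! ### Lemma 2.8, local form: separating one critical value by a bump with small support -/

section Bump

variable {E : Type*} [NormedAddCommGroup E] [NormedSpace ℝ E] [FiniteDimensional ℝ E]
  {H : Type*} [TopologicalSpace H] {I : ModelWithCorners ℝ E H}
  {X : Type u} [TopologicalSpace X] [ChartedSpace H X] [T2Space X] [IsManifold I ∞ X]
  [CompactSpace X]

/-- **Milnor 1965, Lemma 2.8, one local step.**  Let `f` be a Morse function on a compact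
manifold, `p` an interior point (a critical point, in the application), `O` an open set containing `p`, `A` a finite set of
reals and `η > 0`.  Then `g = f + ε ρ` — `ρ` a bump equal to `1` near `p` supported in `O`
and isolating `p` from the other critical points, `ε > 0` small and generic — is a Morse
function with the same critical points and indices as `f`, equal to `f` off `O` and at every
other critical point, everywhere `≥ f` and `< f + η`, with `f p < g p` and `g p ∉ A` (Milnor's
proof, PDF p. 11: `g = f + ε₁λ₁ + ⋯`, "`λᵢ = 1` near `pᵢ`"; the support control is what the
tree's `Cobordism.exists_isMorseFunction_apply_notMem` does not record).
[cite: MilnorHCobordism1965, Lemma 2.8 and its proof (PDF p. 11)] -/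
theorem IsMorse.exists_add_bump_apply_notMem {f : X → ℝ} (hf : IsMorse I f) {p : X}
    (hpint : I.IsInteriorPoint p) {O : Set X} (hO : IsOpen O)
    (hpO : p ∈ O) (A : Finset ℝ) {η : ℝ} (hη : 0 < η) :
    ∃ g : X → ℝ, IsMorse I g ∧ criticalSet I g = criticalSet I f ∧
      (∀ z ∈ criticalSet I f, morseIndex I g z = morseIndex I f z) ∧
      (∀ z, z ∉ O → g z = f z) ∧ (∀ z ∈ criticalSet I f, z ≠ p → g z = f z) ∧
      (∀ z, f z ≤ g z) ∧ f p < g p ∧ (∀ z, g z < f z + η) ∧ ∀ a ∈ A, g p ≠ a := by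
  classical
  have hfs : ContMDiff I 𝓘(ℝ, ℝ) ∞ f := hf.contMDiff
  have hfin : (criticalSet I f).Finite := IsMorse.finite_criticalSet_holds (I := I) (M := X) hf
  -- the chart at `p` and a radius: inside the chart target, inside `O`, isolating `p`
  set φ := extChartAt I p with hφ
  have hpmem : φ p ∈ (interiorExtChart I p).target :=
    (interiorExtChart I p).map_source ⟨mem_chart_source H p, hpint⟩
  have hsymm : ContinuousAt φ.symm (φ p) := continuousAt_extChartAt_symm p
  have hpre : φ.symm ⁻¹' O ∈ 𝓝 (φ p) := by
    apply hsymm.preimage_mem_nhds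
    rw [hφ, extChartAt_to_inv]
    exact hO.mem_nhds hpO
  obtain ⟨r₀, hr₀, hsub₀⟩ := Metric.nhds_basis_closedBall.mem_iff.1
    (inter_mem ((interiorExtChart I p).open_target.mem_nhds hpmem) hpre)
  set others := (hfin.toFinset.erase p).filter fun z => z ∈ (chartAt H p).source with hothers
  obtain ⟨r₁, hr₁, hr₁lt⟩ := exists_pos_lt_of_finset (others.image fun z => dist (φ z) (φ p)) (by
    intro v hv
    obtain ⟨z, hz, rfl⟩ := Finset.mem_image.1 hv
    rw [hothers, Finset.mem_filter, Finset.mem_erase] at hz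
    apply dist_pos.2
    intro h
    have hzs : z ∈ φ.source := by rw [hφ, extChartAt_source]; exact hz.2
    have hps : p ∈ φ.source := by rw [hφ, extChartAt_source]; exact mem_chart_source H p
    exact hz.1.1 (φ.injOn hzs hps h))
  set r := min r₀ r₁ with hr
  have hrpos : 0 < r := lt_min hr₀ hr₁
  set κ : ChartBall I X := ⟨p, r, hrpos, fun z hz =>
    (hsub₀ ((closedBall_subset_closedBall (min_le_left _ _)) hz)).1⟩ with hκ
  -- the support of the bump lies in `O`
  have hTO : tsupport κ.ρ ⊆ O := by
    intro y hy
    obtain ⟨hys, hyd⟩ := κ.tsupport_ρ_subset hy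
    have hy' : φ.symm (φ y) ∈ O :=
      (hsub₀ ((closedBall_subset_closedBall (min_le_left _ _)) (mem_closedBall.2 hyd))).2
    have hysrc : y ∈ φ.source := by rw [hφ, extChartAt_source]; exact hys
    rwa [φ.left_inv hysrc] at hy'
  -- no other critical point within chart-distance `r` of `p`
  have hiso : ∀ z ∈ criticalSet I f, z ∈ (chartAt H p).source → dist (φ z) (φ p) ≤ r → z = p := by
    intro z hz hzs hd
    by_contra hzp
    have hzmem : z ∈ others := by
      rw [hothers, Finset.mem_filter, Finset.mem_erase]
      exact ⟨⟨hzp, hfin.mem_toFinset.2 hz⟩, hzs⟩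
    have := hr₁lt _ (Finset.mem_image_of_mem _ hzmem)
    linarith [min_le_right r₀ r₁]
  -- the compact set where the bump is not locally constant contains no critical point
  set U₀ : Set X := (chartAt H p).source ∩ φ ⁻¹' ball (φ p) (r / 2) with hU₀
  have hU₀open : IsOpen U₀ := by
    rw [hU₀, hφ, ← extChartAt_source I]
    exact isOpen_extChartAt_preimage' p isOpen_ball
  set K : Set X := tsupport κ.ρ \ U₀ with hK
  have hKcpt : IsCompact K := κ.ρ.hasCompactSupport.diff hU₀open
  have hKT : K ⊆ tsupport κ.ρ := fun x hx => hx.1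
  have hKreg : ∀ x ∈ K, ¬ IsMCriticalPt I f x := by
    rintro x ⟨hxT, hxU⟩ hxc
    have hx' := κ.tsupport_ρ_subset hxT
    have hxp : x = p := hiso x hxc hx'.1 hx'.2
    apply hxU
    rw [hxp]
    exact ⟨mem_chart_source H p, by simp [hrpos]⟩
  -- threshold for regularity on `K`; choose `ε` small, positive and generic
  obtain ⟨δ₁, hδ₁, hreg⟩ := κ.exists_forall_not_isMCriticalPt_smul K hKcpt hKT hfs hKreg
  obtain ⟨ε, hεmem, hεgood⟩ : ∃ ε ∈ Ioo 0 (min δ₁ η),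
      ε ∉ (A.image fun a => a - f p : Finset ℝ) := by
    have hinf : (Ioo 0 (min δ₁ η)).Infinite := Ioo_infinite (lt_min hδ₁ hη)
    obtain ⟨ε, hε, hεn⟩ := hinf.exists_notMem_finset (A.image fun a => a - f p)
    exact ⟨ε, hε, hεn⟩
  have hεpos : 0 < ε := hεmem.1
  have hε₁ : |ε| ≤ δ₁ := by rw [abs_of_pos hεpos]; exact hεmem.2.le.trans (min_le_left _ _)
  have hεη : ε < η := lt_of_lt_of_le hεmem.2 (min_le_right _ _)
  set g : X → ℝ := fun z => f z + ε * κ.ρ z with hg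
  have hgs : ContMDiff I 𝓘(ℝ, ℝ) ∞ g := hfs.add (contMDiff_const.mul κ.ρ.contMDiff)
  -- off `K`, `g = f + const` near the point
  have hloc : ∀ x, x ∉ K → ∃ C, g =ᶠ[𝓝 x] fun z => f z + C := by
    intro x hx
    simp only [hK, Set.mem_sdiff, not_and_or, not_not] at hx
    rcases hx with hx | hx
    · exact ⟨0, κ.eventuallyEq_add_zero_of_notMem_tsupport ε hx⟩
    · exact ⟨ε, κ.eventuallyEq_add_const_of_dist_lt ε hx.1 hx.2⟩
  have hcrit_iff : ∀ x, IsMCriticalPt I g x ↔ IsMCriticalPt I f x := by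
    intro x
    by_cases hxK : x ∈ K
    · exact ⟨fun h => absurd h (hreg ε hε₁ x hxK), fun h => absurd h (hKreg x hxK)⟩
    · obtain ⟨C, hC⟩ := hloc x hxK
      exact isMCriticalPt_congr_of_eventuallyEq_add_const hC
  have hcritset : criticalSet I g = criticalSet I f := Set.ext fun x => hcrit_iff x
  have hcritK : ∀ z ∈ criticalSet I f, z ∉ K := fun z hz hzK => hKreg z hzK hz
  have hMorse : IsMorse I g := by
    refine ⟨hgs, fun x hx => ?_⟩
    have hxf : IsMCriticalPt I f x := (hcrit_iff x).1 hx
    obtain ⟨C, hC⟩ := hloc x (hcritK x hxf)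
    rw [mhessian_congr_of_eventuallyEq_add_const hC]
    exact hf.nondegenerate hxf
  have hother : ∀ z ∈ criticalSet I f, z ≠ p → κ.ρ z = 0 := by
    intro z hz hzp
    apply image_eq_zero_of_notMem_tsupport
    intro hzT
    have hz' := κ.tsupport_ρ_subset hzT
    exact hzp (hiso z hz hz'.1 hz'.2)
  have hρp : κ.ρ p = 1 := κ.ρ.one_of_dist_le (mem_chart_source H p) (by
    show dist (extChartAt I p p) (extChartAt I p p) ≤ r / 2
    rw [dist_self]; exact (half_pos hrpos).le)
  refine ⟨g, hMorse, hcritset, fun z hz => ?_, fun z hz => ?_, fun z hz hzp => ?_, fun z => ?_,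
    ?_, fun z => ?_, fun a ha h => ?_⟩
  · obtain ⟨C, hC⟩ := hloc z (hcritK z hz)
    exact morseIndex_congr_of_eventuallyEq_add_const hC
  · show f z + ε * κ.ρ z = f z
    rw [image_eq_zero_of_notMem_tsupport (fun h => hz (hTO h)), mul_zero, add_zero]
  · show f z + ε * κ.ρ z = f z
    rw [hother z hz hzp, mul_zero, add_zero]
  · show f z ≤ f z + ε * κ.ρ z
    have := κ.ρ.nonneg (x := z)
    nlinarith
  · show f p < f p + ε * κ.ρ p
    rw [hρp, mul_one]; linarith
  · show f z + ε * κ.ρ z < f z + η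
    have h1 := κ.ρ.le_one (x := z)
    have h0 := κ.ρ.nonneg (x := z)
    nlinarith
  · apply hεgood
    refine Finset.mem_image.2 ⟨a, ha, ?_⟩
    have : f p + ε * κ.ρ p = a := h
    rw [hρp, mul_one] at this
    linarith

/-- **Distinct critical values above a level, the function frozen below it** (Milnor 1965,
Lemma 2.8, iterated locally).  Let `f` be a Morse function on a compact manifold all of whose
critical points are interior, `t` a real number and `η > 0`.  Then there is a Morse function
`g` with the same critical points and indices, with `g = f` on `{f ≤ t}`, `f ≤ g < f + η`
everywhere, whose values at the critical points in `{t < f}` are pairwise distinct and distinct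
from all other critical values. [cite: MilnorHCobordism1965, Lemma 2.8 and its proof (PDF p. 11)] -/
theorem IsMorse.exists_injOn_above {f : X → ℝ} (hf : IsMorse I f)
    (hint : ∀ z, IsMCriticalPt I f z → I.IsInteriorPoint z) (t : ℝ) {η : ℝ} (hη : 0 < η) :
    ∃ g : X → ℝ, IsMorse I g ∧ criticalSet I g = criticalSet I f ∧
      (∀ z ∈ criticalSet I f, morseIndex I g z = morseIndex I f z) ∧
      (∀ z, f z ≤ t → g z = f z) ∧ (∀ z, f z ≤ g z) ∧ (∀ z, g z < f z + η) ∧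
      (∀ q ∈ criticalSet I f, t < f q → ∀ z ∈ criticalSet I f, z ≠ q → g q ≠ g z) := by
  classical
  have hfin : (criticalSet I f).Finite := IsMorse.finite_criticalSet_holds (I := I) (M := X) hf
  set O : Set X := {z | t < f z} with hOdef
  have hO : IsOpen O := isOpen_lt continuous_const hf.contMDiff.continuous
  -- induction over a list of critical points above `t`, each step using the budget `θ`
  have key : ∀ (todo : List X) (g : X → ℝ) (n : ℕ) (θ : ℝ), 0 < θ → IsMorse I g →
      criticalSet I g = criticalSet I f →
      (∀ z ∈ criticalSet I f, morseIndex I g z = morseIndex I f z) →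
      (∀ z, z ∉ O → g z = f z) → (∀ z, f z ≤ g z) → (∀ z, g z ≤ f z + θ * n) →
      (∀ q ∈ criticalSet I f, q ∈ O → q ∉ todo → ∀ z ∈ criticalSet I f, z ≠ q → g q ≠ g z) →
      ∃ g' : X → ℝ, IsMorse I g' ∧ criticalSet I g' = criticalSet I f ∧
        (∀ z ∈ criticalSet I f, morseIndex I g' z = morseIndex I f z) ∧
        (∀ z, z ∉ O → g' z = f z) ∧ (∀ z, f z ≤ g' z) ∧
        (∀ z, g' z ≤ f z + θ * (n + todo.length)) ∧
        ∀ q ∈ criticalSet I f, q ∈ O → ∀ z ∈ criticalSet I f, z ≠ q → g' q ≠ g' z := by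
    intro todo
    induction todo with
    | nil =>
      intro g n θ hθ hg hcrit hidx hoff hle hbud hdist
      exact ⟨g, hg, hcrit, hidx, hoff, hle, fun z => by simpa using hbud z,
        fun q hq hqO z hz hzq => hdist q hq hqO (by simp) z hz hzq⟩
    | cons p rest ih =>
      intro g n θ hθ hg hcrit hidx hoff hle hbud hdist
      by_cases hp : p ∈ criticalSet I f ∧ p ∈ O
      · obtain ⟨hpc, hpO⟩ := hp
        obtain ⟨g₁, hg₁, hcrit₁, hidx₁, hoff₁, hsame₁, hle₁, -, hlt₁, hnew₁⟩ :=
          hg.exists_add_bump_apply_notMem (hint p hpc) hO hpO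
            ((hfin.toFinset.erase p).image g) hθ
        rw [hcrit] at hcrit₁ hidx₁ hsame₁
        obtain ⟨g', hg', hcrit', hidx', hoff', hle', hbud', hdist'⟩ := ih g₁ (n + 1) θ hθ hg₁ hcrit₁
          (fun z hz => (hidx₁ z hz).trans (hidx z hz))
          (fun z hz => (hoff₁ z hz).trans (hoff z hz))
          (fun z => (hle z).trans (hle₁ z))
          (fun z => by
            have h1 := hlt₁ z
            have h2 := hbud z
            push_cast
            nlinarith)
          (by
            intro q hq hqO hqrest z hz hzq
            by_cases hqp : q = p
            · subst hqp
              rw [hsame₁ z hz hzq]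
              intro h
              exact hnew₁ (g z) (Finset.mem_image.2 ⟨z, Finset.mem_erase.2 ⟨hzq, hfin.mem_toFinset.2 hz⟩, rfl⟩) h
            · have hqtodo : q ∉ p :: rest := by simp [hqp, hqrest]
              rw [hsame₁ q hq hqp]
              by_cases hzp : z = p
              · subst hzp
                intro h
                exact hnew₁ (g q) (Finset.mem_image.2 ⟨q, Finset.mem_erase.2 ⟨hqp, hfin.mem_toFinset.2 hq⟩, rfl⟩) h.symm
              · rw [hsame₁ z hz hzp]
                exact hdist q hq hqO hqtodo z hz hzq)
        refine ⟨g', hg', hcrit', hidx', hoff', hle', fun z => ?_, hdist'⟩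
        have := hbud' z
        push_cast at this ⊢
        simp only [List.length_cons, Nat.cast_add, Nat.cast_one]
        nlinarith
      · obtain ⟨g', hg', hcrit', hidx', hoff', hle', hbud', hdist'⟩ := ih g n θ hθ hg hcrit hidx hoff hle hbud
          (fun q hq hqO hqrest => hdist q hq hqO (by
            simp only [List.mem_cons, not_or]
            exact ⟨fun h => hp ⟨h ▸ hq, h ▸ hqO⟩, hqrest⟩))
        refine ⟨g', hg', hcrit', hidx', hoff', hle', fun z => ?_, hdist'⟩
        have := hbud' z
        simp only [List.length_cons, Nat.cast_add, Nat.cast_one]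
        nlinarith
  -- run it on the list of critical points above `t`
  set todo : List X := hfin.toFinset.toList with htodo
  set L : ℕ := todo.length with hL
  have hθ : 0 < η / (L + 1) := by positivity
  obtain ⟨g, hg, hcrit, hidx, hoff, hle, hbud, hdist⟩ := key todo f 0 (η / (L + 1)) hθ hf rfl
    (fun _ _ => rfl) (fun _ _ => rfl) (fun _ => le_rfl) (fun z => by simp)
    (fun q hq _ hqn => absurd (Finset.mem_toList.2 (hfin.mem_toFinset.2 hq)) hqn)
  refine ⟨g, hg, hcrit, hidx, fun z hz => hoff z (not_lt.2 hz), hle, fun z => ?_,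
    fun q hq hqt z hz hzq => hdist q hq hqt z hz hzq⟩
  have h1 := hbud z
  have hL' : (η / (L + 1)) * (0 + (L : ℝ)) < η := by
    rw [zero_add, div_mul_eq_mul_div, div_lt_iff₀ (by positivity)]
    nlinarith
  have : (η / (↑L + 1)) * (↑(0 : ℕ) + ↑todo.length) = (η / (L + 1)) * (0 + (L : ℝ)) := by
    simp [hL]
  linarith [this ▸ h1]

end Bump

/-! ### Thm. 4.8 above a barrier: bubble sort by slab swaps that never go below `t` -/

section SortAbove

variable {n : ℕ} {M N : Type u} [TopologicalSpace M] [T2Space M] [SecondCountableTopology M]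
  [ChartedSpace (EuclideanSpace ℝ (Fin n)) M] [IsManifold (𝓡 n) ∞ M] [CompactSpace M]
  [TopologicalSpace N] [T2Space N] [SecondCountableTopology N]
  [ChartedSpace (EuclideanSpace ℝ (Fin n)) N] [IsManifold (𝓡 n) ∞ N] [CompactSpace N]
  {c : Cobordism n M N} {f₀ : c.W → ℝ} {t : ℝ} {S : Finset c.W}

namespace Cobordism

/-- **One adjacent swap above the barrier `t`.**  Setting: `g` has the same critical points and
indices as `f₀`, agrees with `f₀` on `{f₀ ≤ t}`, `t ≥ 0` is not a critical value of `f₀`, `S`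
is the set of critical points of `f₀` above `t`, on which `g` is injective with values `> t`.
If the levels of `g` on `S` have an inversion against the indices, one application of the slab
form of Milnor's Thms. 4.4 + 4.1/4.2 (`Milnor1965_rearrange_consecutive_levels_holds`) to an
adjacent inverted pair, in a slab `[a, b]` with `t ≤ a`, exchanges the two levels, lowers the
number of inversions and keeps all the rest — in particular the function on `{f₀ ≤ t}`.
[cite: MilnorHCobordism1965, Thm. 4.8 from 4.1, 4.2, 4.4 (PDF p. 25)] -/
theorem sort_step_above (ht : 0 ≤ t) (htc : ∀ z ∈ criticalSet (𝓡∂ (n + 1)) f₀, f₀ z ≠ t)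
    (hS : ∀ z, z ∈ S ↔ z ∈ criticalSet (𝓡∂ (n + 1)) f₀ ∧ t < f₀ z) {g : c.W → ℝ}
    (hg : c.SameCritical f₀ g) (hfix : ∀ z, f₀ z ≤ t → g z = f₀ z) (hgt : ∀ z ∈ S, t < g z)
    (hinj : InjOn g S)
    (hinv : (Rearrangement.inversions S g (morseIndex (𝓡∂ (n + 1)) f₀)).Nonempty) :
    ∃ g' : c.W → ℝ, c.SameCritical f₀ g' ∧ (∀ z, f₀ z ≤ t → g' z = f₀ z) ∧
      (∀ z ∈ S, t < g' z) ∧ InjOn g' S ∧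
      (Rearrangement.inversions S g' (morseIndex (𝓡∂ (n + 1)) f₀)).card <
        (Rearrangement.inversions S g (morseIndex (𝓡∂ (n + 1)) f₀)).card := by
  classical
  obtain ⟨p, hp, q, hq, hlt, hι, hadj⟩ := Rearrangement.exists_adjacent_inversion hinv
  have hpc : p ∈ criticalSet (𝓡∂ (n + 1)) f₀ := ((hS p).1 hp).1
  have hqc : q ∈ criticalSet (𝓡∂ (n + 1)) f₀ := ((hS q).1 hq).1
  have hpt : t < g p := hgt p hp
  have hq1 : g q < 1 := (hg.apply_mem_Ioo hqc).2
  obtain ⟨a, hta, hap, ha⟩ := exists_gap_below (S.image g) (ℓ := t) hpt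
  obtain ⟨b, hqb, hb1, hb⟩ := exists_gap_above (S.image g) (h := 1) hq1
  have ha0 : 0 ≤ a := ht.trans hta
  -- the slab `[a, b]` contains no critical point other than `p`, `q`
  have hPQ : ∀ z ∈ criticalSet (𝓡∂ (n + 1)) g, g z ∈ Icc a b → z ∈ ({p} : Set c.W) ∪ {q} := by
    intro z hz hzab
    rw [hg.2.1] at hz
    by_cases hzS : z ∈ S
    · have hzV : g z ∈ S.image g := Finset.mem_image_of_mem g hzS
      rcases lt_trichotomy (g z) (g p) with h | h | h
      · exact absurd hzab.1 (not_le.2 (ha _ hzV h))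
      · exact Or.inl (hinj hzS hp h)
      · rcases lt_trichotomy (g z) (g q) with h' | h' | h'
        · exact absurd ⟨h, h'⟩ (hadj z hzS)
        · exact Or.inr (hinj hzS hq h')
        · exact absurd hzab.2 (not_le.2 (hb _ hzV h'))
    · -- a critical point below the barrier: `g z = f₀ z < t ≤ a`
      have hzt : f₀ z ≤ t := by
        by_contra h
        exact hzS ((hS z).2 ⟨hz, not_le.1 h⟩)
      have hlt' : f₀ z < t := lt_of_le_of_ne hzt (htc z hz)
      rw [hfix z hzt] at hzab
      exact absurd hzab.1 (not_le.2 (hlt'.trans_le hta))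
  obtain ⟨g', hg'M, hcrit', hidx', hout, hP', hQ'⟩ := Milnor1965_rearrange_consecutive_levels_holds
    hg.1 ha0 hap hlt hqb hb1 (P := {p}) (Q := {q}) (singleton_nonempty p) (singleton_nonempty q)
    (by rw [singleton_subset_iff, hg.2.1]; exact hpc) (by rw [singleton_subset_iff, hg.2.1]; exact hqc)
    (fun z hz => by rw [mem_singleton_iff.1 hz]) (fun z hz => by rw [mem_singleton_iff.1 hz]) hPQ
    (k := morseIndex (𝓡∂ (n + 1)) f₀ p) (k' := morseIndex (𝓡∂ (n + 1)) f₀ q) hι.le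
    (fun z hz => by rw [mem_singleton_iff.1 hz]; exact hg.2.2 p hpc)
    (fun z hz => by rw [mem_singleton_iff.1 hz]; exact hg.2.2 q hqc)
    (a' := g q) (b' := g p) ⟨by linarith, hqb⟩ ⟨hap, by linarith⟩
  have hsame : c.SameCritical f₀ g' := hg.trans ⟨hg'M, hcrit', hidx'⟩
  have hv'p : g' p = g q := hP' p rfl
  have hv'q : g' q = g p := hQ' q rfl
  have hv' : ∀ r ∈ S, r ≠ p → r ≠ q → g' r = g r := by
    intro r hr hrp hrq
    apply hout
    intro hmem
    have := hPQ r (by rw [hg.2.1]; exact ((hS r).1 hr).1) (Ioo_subset_Icc_self hmem)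
    simp only [union_singleton, mem_insert_iff, mem_singleton_iff] at this
    tauto
  -- the new levels are the old ones composed with the transposition of `p` and `q`
  have hswap : ∀ z ∈ S, g' z = g (Equiv.swap p q z) := by
    intro z hz
    by_cases hzp : z = p
    · subst hzp; rw [Equiv.swap_apply_left, hv'p]
    by_cases hzq : z = q
    · subst hzq; rw [Equiv.swap_apply_right, hv'q]
    · rw [Equiv.swap_apply_of_ne_of_ne hzp hzq, hv' z hz hzp hzq]
  have hswapS : ∀ z ∈ S, Equiv.swap p q z ∈ S := by
    intro z hz
    by_cases hzp : z = p
    · subst hzp; rwa [Equiv.swap_apply_left]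
    by_cases hzq : z = q
    · subst hzq; rwa [Equiv.swap_apply_right]
    · rwa [Equiv.swap_apply_of_ne_of_ne hzp hzq]
  refine ⟨g', hsame, fun z hz => ?_, fun z hz => ?_, fun z hz w hw hzw => ?_, ?_⟩
  · -- frozen below `t`: `g z = f₀ z ≤ t ≤ a`
    have : g z ∉ Ioo a b := fun h => not_le.2 h.1 ((hfix z hz).symm ▸ hz.trans hta)
    rw [hout z this, hfix z hz]
  · rw [hswap z hz]; exact hgt _ (hswapS z hz)
  · rw [hswap z hz, hswap w hw] at hzw
    exact (Equiv.swap p q).injective (hinj (hswapS z hz) (hswapS w hw) hzw)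
  · exact Rearrangement.card_inversions_swap_lt hp hq hinj hlt hι hadj hv'p hv'q hv'

/-- **Sorting above the barrier** (finitely many swaps `sort_step_above`): with the notation
there, the function can be rearranged above `t` — keeping critical points, indices, the
function on `{f₀ ≤ t}`, injectivity on `S` and the values `> t` on `S` — so that the levels on
`S` have no inversion against the indices. [cite: MilnorHCobordism1965, Thm. 4.8 from 4.1, 4.2, 4.4 (PDF p. 25)] -/
theorem sort_above (ht : 0 ≤ t) (htc : ∀ z ∈ criticalSet (𝓡∂ (n + 1)) f₀, f₀ z ≠ t)
    (hS : ∀ z, z ∈ S ↔ z ∈ criticalSet (𝓡∂ (n + 1)) f₀ ∧ t < f₀ z) :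
    ∀ (m : ℕ) {g : c.W → ℝ}, c.SameCritical f₀ g → (∀ z, f₀ z ≤ t → g z = f₀ z) →
      (∀ z ∈ S, t < g z) → InjOn g S →
      (Rearrangement.inversions S g (morseIndex (𝓡∂ (n + 1)) f₀)).card ≤ m →
      ∃ g' : c.W → ℝ, c.SameCritical f₀ g' ∧ (∀ z, f₀ z ≤ t → g' z = f₀ z) ∧
        (∀ z ∈ S, t < g' z) ∧ InjOn g' S ∧
        Rearrangement.inversions S g' (morseIndex (𝓡∂ (n + 1)) f₀) = ∅ := by
  classical
  intro m
  induction m with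
  | zero =>
    intro g hg hfix hgt hinj hcard
    exact ⟨g, hg, hfix, hgt, hinj, Finset.card_eq_zero.1 (Nat.le_zero.1 hcard)⟩
  | succ m ih =>
    intro g hg hfix hgt hinj hcard
    by_cases h0 : Rearrangement.inversions S g (morseIndex (𝓡∂ (n + 1)) f₀) = ∅
    · exact ⟨g, hg, hfix, hgt, hinj, h0⟩
    · obtain ⟨g', hg', hfix', hgt', hinj', hlt⟩ :=
        sort_step_above ht htc hS hg hfix hgt hinj (Finset.nonempty_iff_ne_empty.2 h0)
      exact ih hg' hfix' hgt' hinj' (Nat.lt_succ_iff.1 (lt_of_lt_of_le hlt hcard))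

end Cobordism

end SortAbove

/-! ### Closed manifolds: ordering above a frozen sublevel set -/

section Closed

open HalfSpaceCharted

variable {k : ℕ} {Y : Type u} [TopologicalSpace Y] [T2Space Y] [SecondCountableTopology Y]
  [CompactSpace Y] [ChartedSpace (EuclideanSpace ℝ (Fin (k + 1))) Y] [IsManifold (𝓡 (k + 1)) ∞ Y]

/-- **Milnor 1965, Thm. 4.8 above a level, on a closed manifold.**  Let `f` be a Morse
function with values in `(0, 1)` on a closed manifold `Y`, and `t ∈ [0, 1)` not a critical value.
Then there is a Morse function `g` with the same critical points and indices, **equal to `f`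
on `{f ≤ t}`**, with values in `(0, 1)`, whose values at the critical points above `t` stay
above `t`, are pairwise distinct and **increase weakly with the index**.  Proof: Lemma 2.8
above `t` (`IsMorse.exists_injOn_above`, with `η = 1 - max f`), then bubble sort by slab
swaps above `t` on the cobordism `(Y; ∅, ∅)` (`Cobordism.sort_above`, `Cobordism.ofClosed`).
[cite: MilnorHCobordism1965, Thm. 4.8 from 4.1, 4.2, 4.4 (PDF p. 25); Lemma 2.8 (PDF p. 11)] -/
theorem IsMorse.exists_sorted_above {f : Y → ℝ} (hf : IsMorse (𝓡 (k + 1)) f)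
    (h01 : ∀ y, f y ∈ Ioo 0 1) {t : ℝ} (ht : 0 ≤ t)
    (htc : ∀ z, IsMCriticalPt (𝓡 (k + 1)) f z → f z ≠ t) :
    ∃ g : Y → ℝ, IsMorse (𝓡 (k + 1)) g ∧ criticalSet (𝓡 (k + 1)) g = criticalSet (𝓡 (k + 1)) f ∧
      (∀ z ∈ criticalSet (𝓡 (k + 1)) f, morseIndex (𝓡 (k + 1)) g z = morseIndex (𝓡 (k + 1)) f z) ∧
      (∀ y, f y ≤ t → g y = f y) ∧ (∀ y, g y ∈ Ioo 0 1) ∧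
      (∀ z ∈ criticalSet (𝓡 (k + 1)) f, t < f z → t < g z) ∧
      (∀ z ∈ criticalSet (𝓡 (k + 1)) f, ∀ w ∈ criticalSet (𝓡 (k + 1)) f, t < f z → t < f w →
        z ≠ w → g z ≠ g w) ∧
      ∀ z ∈ criticalSet (𝓡 (k + 1)) f, ∀ w ∈ criticalSet (𝓡 (k + 1)) f, t < f z → t < f w →
        g z < g w → morseIndex (𝓡 (k + 1)) f z ≤ morseIndex (𝓡 (k + 1)) f w := by
  classical
  rcases isEmpty_or_nonempty Y with hY | hY
  · exact ⟨f, hf, rfl, fun _ _ => rfl, fun _ _ => rfl, h01, fun z => isEmptyElim z,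
      fun z => isEmptyElim z, fun z => isEmptyElim z⟩
  have hfin : (criticalSet (𝓡 (k + 1)) f).Finite :=
    IsMorse.finite_criticalSet_holds (I := 𝓡 (k + 1)) (M := Y) hf
  -- Step 1: distinct values above `t`, frozen below, still `< 1`
  obtain ⟨y₁, -, hmax⟩ := isCompact_univ.exists_isMaxOn univ_nonempty hf.contMDiff.continuous.continuousOn
  set η : ℝ := 1 - f y₁ with hη
  have hηpos : 0 < η := by have := (h01 y₁).2; linarith
  obtain ⟨g₁, hg₁, hcrit₁, hidx₁, hfix₁, hle₁, hlt₁, hdist₁⟩ :=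
    hf.exists_injOn_above (fun z _ => BoundarylessManifold.isInteriorPoint) t hηpos
  have hg₁01 : ∀ y, g₁ y ∈ Ioo 0 1 := fun y =>
    ⟨(h01 y).1.trans_le (hle₁ y), by
      have h1 := hlt₁ y
      have h2 : f y ≤ f y₁ := hmax (mem_univ y)
      linarith⟩
  have hup₁ : ∀ z ∈ criticalSet (𝓡 (k + 1)) f, t < f z → t < g₁ z := fun z _ hz =>
    hz.trans_le (hle₁ z)
  -- Step 2: on the cobordism `(Y; ∅, ∅)` (total space `HalfSpaceCharted Y`)
  set G : HalfSpaceCharted Y → ℝ := g₁ ∘ of.symm with hGdef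
  have hG : (Cobordism.ofClosed k Y).IsMorseFunction (g₁ ∘ of.symm) :=
    Cobordism.isMorseFunction_ofClosed_iff.2 ⟨hg₁, hg₁01⟩
  have hcritG : criticalSet (𝓡∂ (k + 1)) G = of.symm ⁻¹' criticalSet (𝓡 (k + 1)) f := by
    rw [hGdef, criticalSet_eq g₁, hcrit₁]
  have hvalG : ∀ w, G w = g₁ (of.symm w) := fun w => rfl
  have hofof : ∀ z : Y, of.symm (of z) = z := fun z => rfl
  set S : Finset (HalfSpaceCharted Y) := (hfin.toFinset.filter fun z => t < f z).image of with hSdef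
  have hSiff : ∀ w : HalfSpaceCharted Y, w ∈ S ↔
      of.symm w ∈ criticalSet (𝓡 (k + 1)) f ∧ t < f (of.symm w) := by
    intro w
    simp only [hSdef, Finset.mem_image, Finset.mem_filter, Set.Finite.mem_toFinset]
    constructor
    · rintro ⟨z, ⟨hz, hzt⟩, rfl⟩
      exact ⟨hz, hzt⟩
    · rintro ⟨h1, h2⟩
      exact ⟨of.symm w, ⟨h1, h2⟩, by simp⟩
  have hSof : ∀ z : Y, of z ∈ S ↔ z ∈ criticalSet (𝓡 (k + 1)) f ∧ t < f z := fun z => hSiff (of z)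
  have hS : ∀ w, w ∈ S ↔ w ∈ criticalSet (𝓡∂ (k + 1)) G ∧ t < G w := by
    intro w
    rw [hSiff, hcritG, hvalG]
    show _ ↔ of.symm w ∈ criticalSet (𝓡 (k + 1)) f ∧ t < g₁ (of.symm w)
    constructor
    · rintro ⟨h1, h2⟩; exact ⟨h1, hup₁ _ h1 h2⟩
    · rintro ⟨h1, h2⟩
      refine ⟨h1, ?_⟩
      by_contra h
      rw [hfix₁ _ (not_lt.1 h)] at h2
      exact h h2
  have htcG : ∀ w ∈ criticalSet (𝓡∂ (k + 1)) G, G w ≠ t := by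
    intro w hw
    rw [hcritG] at hw
    have hw' : of.symm w ∈ criticalSet (𝓡 (k + 1)) f := hw
    rw [hvalG]
    by_cases h : t < f (of.symm w)
    · exact (hup₁ _ hw' h).ne'
    · rw [hfix₁ _ (not_lt.1 h)]; exact htc _ hw'
  have hinjG : InjOn G S := by
    intro w hw w' hw' h
    obtain ⟨hwc, hwt⟩ := (hSiff w).1 hw
    obtain ⟨hw'c, -⟩ := (hSiff w').1 hw'
    by_contra hne
    exact hdist₁ _ hwc hwt _ hw'c (fun h' => hne (of.symm.injective h').symm) h
  -- Step 3: sort above `t`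
  obtain ⟨G', hG', hfix', hgt', hinj', hsorted⟩ := Cobordism.sort_above (c := Cobordism.ofClosed k Y)
    (f₀ := G) (S := S) ht htcG hS _ (Cobordism.SameCritical.refl hG) (fun _ _ => rfl)
    (fun w hw => ((hS w).1 hw).2) hinjG le_rfl
  -- Step 4: back to `Y`
  set g : Y → ℝ := fun y => G' (of y) with hgdef
  have hgG : g ∘ of.symm = G' := by
    funext w
    show G' (of (of.symm w)) = G' w
    rw [Equiv.apply_symm_apply]
  have hG'M : IsMorse (𝓡∂ (k + 1)) (g ∘ of.symm) := by rw [hgG]; exact hG'.1.isMorse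
  have hG'crit : criticalSet (𝓡∂ (k + 1)) (g ∘ of.symm) = criticalSet (𝓡∂ (k + 1)) G := by
    rw [hgG]; exact hG'.2.1
  have hG'idx : ∀ w ∈ criticalSet (𝓡∂ (k + 1)) G,
      morseIndex (𝓡∂ (k + 1)) (g ∘ of.symm) w = morseIndex (𝓡∂ (k + 1)) G w := by
    rw [hgG]; exact hG'.2.2
  have hG'val : ∀ w, w ∈ (𝓡∂ (k + 1)).interior (HalfSpaceCharted Y) → G' w ∈ Ioo 0 1 :=
    hG'.1.2.2.2.2
  have hgM : IsMorse (𝓡 (k + 1)) g := isMorse_iff.1 hG'M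
  have hcritg : criticalSet (𝓡 (k + 1)) g = criticalSet (𝓡 (k + 1)) f := by
    have h1 : criticalSet (𝓡∂ (k + 1)) (g ∘ of.symm) = of.symm ⁻¹' criticalSet (𝓡 (k + 1)) g :=
      criticalSet_eq g
    rw [hG'crit, hcritG] at h1
    ext z
    have := Set.ext_iff.1 h1 (of z)
    exact this.symm
  have hidxG : ∀ z ∈ criticalSet (𝓡 (k + 1)) f,
      morseIndex (𝓡∂ (k + 1)) G (of z) = morseIndex (𝓡 (k + 1)) f z := by
    intro z hz
    rw [hGdef, morseIndex_eq ((hg₁.contMDiff z).of_le (by norm_cast))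
      (by rw [← mem_criticalSet, hcrit₁]; exact hz), hidx₁ z hz]
  have hofcrit : ∀ z ∈ criticalSet (𝓡 (k + 1)) f, of z ∈ criticalSet (𝓡∂ (k + 1)) G := by
    intro z hz; rw [hcritG]; exact hz
  have hidxg : ∀ z ∈ criticalSet (𝓡 (k + 1)) f, morseIndex (𝓡 (k + 1)) g z = morseIndex (𝓡 (k + 1)) f z := by
    intro z hz
    have hzg : IsMCriticalPt (𝓡 (k + 1)) g z := by rw [← mem_criticalSet, hcritg]; exact hz
    have h1 : morseIndex (𝓡∂ (k + 1)) (g ∘ of.symm) (of z) = morseIndex (𝓡 (k + 1)) g z :=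
      morseIndex_eq ((hgM.contMDiff z).of_le (by norm_cast)) hzg
    rw [← h1, hG'idx _ (hofcrit z hz), hidxG z hz]
  have hval : ∀ y, g y ∈ Ioo 0 1 := fun y =>
    hG'val (of y) (by rw [HalfSpaceCharted.interior_eq_univ]; trivial)
  refine ⟨g, hgM, hcritg, hidxg, fun y hy => ?_, hval, fun z hz hzt => ?_,
    fun z hz w hw hzt hwt hzw h => ?_, fun z hz w hw hzt hwt hlt => ?_⟩
  · have h1 : G (of y) ≤ t := by show g₁ y ≤ t; rw [hfix₁ y hy]; exact hy
    exact (hfix' (of y) h1).trans (hfix₁ y hy)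
  · exact hgt' (of z) ((hSof z).2 ⟨hz, hzt⟩)
  · exact hzw (of.injective (hinj' ((hSof z).2 ⟨hz, hzt⟩) ((hSof w).2 ⟨hw, hwt⟩) h))
  · have h := Rearrangement.sorted_of_inversions_eq_empty hsorted ((hSof z).2 ⟨hz, hzt⟩)
      ((hSof w).2 ⟨hw, hwt⟩) hlt
    have h' : morseIndex (𝓡∂ (k + 1)) G (of z) ≤ morseIndex (𝓡∂ (k + 1)) G (of w) := h
    rw [hidxG z hz, hidxG w hw] at h'
    exact h'

/-- **An ordered Morse function above a frozen sublevel set** (the form consumed by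
Gay–Kirby's Lemma 14).  Let `f` be a Morse function with values in `(0, 1)` on a closed
manifold, `t ∈ [0, 1)` not a critical value, such that every critical point in `{f ≤ t}` has
index `≤ 1`.  Then there are a Morse function `g` with the same critical points and indices,
**equal to `f` on `{f ≤ t}`**, with values in `(0, 1)`, and a level `b ∈ (t, 1)` through no
critical point of `g` such that **every critical point of `g` below `b` has index `≤ 1` and
every critical point above `b` has index `≥ 2`** (`IsMorse.exists_sorted_above`, then `b`
between the largest value at an upper critical point of index `≤ 1` — or `t` — and the smallest
value at one of index `≥ 2` — or `1`).  With `MorseOrderedSublevelConnected.lean` and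
`TrisectionsHandleCounts.lean`: `{g ≤ b}` and `{b ≤ g}` are connected and, in dimension `3`,
handlebodies with one `0`-handle — the Heegaard splitting adapted to the standard form frozen
in `{f ≤ t}`. [cite: MilnorHCobordism1965, Thm. 4.8 (PDF p. 25)] [cite: GayKirby2016, §4, Lemma 14] -/
theorem IsMorse.exists_ordered_above {f : Y → ℝ} (hf : IsMorse (𝓡 (k + 1)) f)
    (h01 : ∀ y, f y ∈ Ioo 0 1) {t : ℝ} (ht : 0 ≤ t) (ht1 : t < 1)
    (htc : ∀ z, IsMCriticalPt (𝓡 (k + 1)) f z → f z ≠ t)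
    (hlow : ∀ z, IsMCriticalPt (𝓡 (k + 1)) f z → f z ≤ t → morseIndex (𝓡 (k + 1)) f z ≤ 1) :
    ∃ (g : Y → ℝ) (b : ℝ), IsMorse (𝓡 (k + 1)) g ∧
      criticalSet (𝓡 (k + 1)) g = criticalSet (𝓡 (k + 1)) f ∧
      (∀ z ∈ criticalSet (𝓡 (k + 1)) f, morseIndex (𝓡 (k + 1)) g z = morseIndex (𝓡 (k + 1)) f z) ∧
      (∀ y, f y ≤ t → g y = f y) ∧ (∀ y, g y ∈ Ioo 0 1) ∧ t < b ∧ b < 1 ∧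
      (∀ z, IsMCriticalPt (𝓡 (k + 1)) g z → g z ≠ b) ∧
      (∀ z, IsMCriticalPt (𝓡 (k + 1)) g z → g z < b → morseIndex (𝓡 (k + 1)) g z ≤ 1) ∧
      (∀ z, IsMCriticalPt (𝓡 (k + 1)) g z → b < g z → 2 ≤ morseIndex (𝓡 (k + 1)) g z) := by
  classical
  obtain ⟨g, hg, hcrit, hidx, hfix, hval, hup, hinj, hsort⟩ := hf.exists_sorted_above h01 ht htc
  have hfin : (criticalSet (𝓡 (k + 1)) f).Finite :=
    IsMorse.finite_criticalSet_holds (I := 𝓡 (k + 1)) (M := Y) hf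
  set U : Finset Y := hfin.toFinset.filter fun z => t < f z with hU
  have hmemU : ∀ z, z ∈ U ↔ z ∈ criticalSet (𝓡 (k + 1)) f ∧ t < f z := fun z => by
    simp only [hU, Finset.mem_filter, Set.Finite.mem_toFinset]
  set V₁ : Finset ℝ := (U.filter fun z => morseIndex (𝓡 (k + 1)) f z ≤ 1).image g with hV₁
  set V₂ : Finset ℝ := (U.filter fun z => 2 ≤ morseIndex (𝓡 (k + 1)) f z).image g with hV₂
  have hmemV₁ : ∀ v, v ∈ V₁ ↔ ∃ z, z ∈ criticalSet (𝓡 (k + 1)) f ∧ t < f z ∧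
      morseIndex (𝓡 (k + 1)) f z ≤ 1 ∧ g z = v := fun v => by
    simp only [hV₁, Finset.mem_image, Finset.mem_filter, hmemU]
    constructor
    · rintro ⟨z, ⟨⟨h1, h2⟩, h3⟩, h4⟩; exact ⟨z, h1, h2, h3, h4⟩
    · rintro ⟨z, h1, h2, h3, h4⟩; exact ⟨z, ⟨⟨h1, h2⟩, h3⟩, h4⟩
  have hmemV₂ : ∀ v, v ∈ V₂ ↔ ∃ z, z ∈ criticalSet (𝓡 (k + 1)) f ∧ t < f z ∧
      2 ≤ morseIndex (𝓡 (k + 1)) f z ∧ g z = v := fun v => by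
    simp only [hV₂, Finset.mem_image, Finset.mem_filter, hmemU]
    constructor
    · rintro ⟨z, ⟨⟨h1, h2⟩, h3⟩, h4⟩; exact ⟨z, h1, h2, h3, h4⟩
    · rintro ⟨z, h1, h2, h3, h4⟩; exact ⟨z, ⟨⟨h1, h2⟩, h3⟩, h4⟩
  -- every value in `V₁` is below every value in `V₂` and below `1`; `t` is below both
  have h12 : ∀ v₁ ∈ V₁, ∀ v₂ ∈ V₂, v₁ < v₂ := by
    intro v₁ hv₁ v₂ hv₂
    obtain ⟨z, hz, hzt, hzi, rfl⟩ := (hmemV₁ v₁).1 hv₁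
    obtain ⟨w, hw, hwt, hwi, rfl⟩ := (hmemV₂ v₂).1 hv₂
    have hzw : z ≠ w := fun h => by rw [h] at hzi; omega
    have hne : g z ≠ g w := hinj z hz w hw hzt hwt hzw
    rcases lt_or_gt_of_ne hne with h | h
    · exact h
    · have := hsort w hw z hz hwt hzt h
      omega
  have ht2 : ∀ v₂ ∈ V₂, t < v₂ := by
    intro v₂ hv₂
    obtain ⟨w, hw, hwt, -, rfl⟩ := (hmemV₂ v₂).1 hv₂
    exact hup w hw hwt
  set m₁ : ℝ := (insert t V₁).max' (Finset.insert_nonempty t V₁) with hm₁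
  set m₂ : ℝ := if h : V₂.Nonempty then V₂.min' h else 1 with hm₂
  have htm₁ : t ≤ m₁ := Finset.le_max' _ t (Finset.mem_insert_self t V₁)
  have hV₁m₁ : ∀ v ∈ V₁, v ≤ m₁ := fun v hv => Finset.le_max' _ v (Finset.mem_insert_of_mem hv)
  have hm₂V₂ : ∀ v ∈ V₂, m₂ ≤ v := by
    intro v hv
    have hne : V₂.Nonempty := ⟨v, hv⟩
    rw [hm₂, dif_pos hne]
    exact Finset.min'_le _ v hv
  have hm₂1 : m₂ ≤ 1 := by
    rw [hm₂]
    split_ifs with hne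
    · obtain ⟨w, -, -, -, hw⟩ := (hmemV₂ _).1 (Finset.min'_mem V₂ hne)
      rw [← hw]; exact (hval w).2.le
    · exact le_rfl
  have hm₁m₂ : m₁ < m₂ := by
    have hm₁mem : m₁ ∈ insert t V₁ := Finset.max'_mem _ _
    -- `m₂` is `1` or a value in `V₂`
    have hm₂case : m₂ = 1 ∨ m₂ ∈ V₂ := by
      rw [hm₂]
      split_ifs with hne
      · exact Or.inr (Finset.min'_mem V₂ hne)
      · exact Or.inl rfl
    rcases Finset.mem_insert.1 hm₁mem with h | h
    · rw [h]
      rcases hm₂case with h2 | h2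
      · rw [h2]; exact ht1
      · exact ht2 _ h2
    · rcases hm₂case with h2 | h2
      · obtain ⟨z, -, -, -, hz⟩ := (hmemV₁ _).1 h
        rw [h2, ← hz]; exact (hval z).2
      · exact h12 _ h _ h2
  set b : ℝ := (m₁ + m₂) / 2 with hb
  have hm₁b : m₁ < b := by rw [hb]; linarith
  have hbm₂ : b < m₂ := by rw [hb]; linarith
  -- the three kinds of critical points of `g`
  have hclass : ∀ z, IsMCriticalPt (𝓡 (k + 1)) g z →
      (g z < b ∧ morseIndex (𝓡 (k + 1)) g z ≤ 1) ∨ (b < g z ∧ 2 ≤ morseIndex (𝓡 (k + 1)) g z) := by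
    intro z hz
    have hzf : z ∈ criticalSet (𝓡 (k + 1)) f := by rw [← hcrit]; exact hz
    rw [hidx z hzf]
    by_cases hzt : f z ≤ t
    · left
      refine ⟨?_, hlow z hzf hzt⟩
      rw [hfix z hzt]
      exact lt_of_le_of_lt (hzt.trans htm₁) hm₁b
    · have hzt' : t < f z := not_le.1 hzt
      by_cases hi : morseIndex (𝓡 (k + 1)) f z ≤ 1
      · left
        exact ⟨lt_of_le_of_lt (hV₁m₁ _ ((hmemV₁ _).2 ⟨z, hzf, hzt', hi, rfl⟩)) hm₁b, hi⟩
      · right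
        exact ⟨hbm₂.trans_le (hm₂V₂ _ ((hmemV₂ _).2 ⟨z, hzf, hzt', by omega, rfl⟩)), by omega⟩
  refine ⟨g, b, hg, hcrit, hidx, hfix, hval, lt_of_le_of_lt htm₁ hm₁b, hbm₂.trans_le hm₂1,
    fun z hz h => ?_, fun z hz h => ?_, fun z hz h => ?_⟩
  · rcases hclass z hz with ⟨h1, -⟩ | ⟨h1, -⟩
    · exact h1.ne h
    · exact h1.ne' h
  · rcases hclass z hz with ⟨-, h2⟩ | ⟨h1, -⟩
    · exact h2
    · exact absurd (h.trans h1) (lt_irrefl _)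
  · rcases hclass z hz with ⟨h1, -⟩ | ⟨-, h2⟩
    · exact absurd (h.trans h1) (lt_irrefl _)
    · exact h2

end Closed



end Literature.Topology.FourManifolds

end
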